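import Summits.NavierStokesRegularity.NavierStokesRegularity.Theorems.PerpetualPumpEulerTypeIGlueDuhamel
import Mathlib.Analysis.SpecialFunctions.Integrability.Basic

/-!
# Stub E (`localExistence`) for `PerpetualPump.Thesis`, part II: the lifted Duhamel integral

Support file (part 2 of the stub `localExistence` of line `SketchIdeator2`, crux
stmt-NavierStokesRegularity-1832). For Tao's local `H¹⁰` theory (J. Amer. Math. Soc. 29 (2016),
arXiv:1402.0290v3, §1.1 after (1.15)) run on the lifted level `g = ⟨D⟩¹⁰u ∈ L²(ℝ³; ℂ³)`, the
Duhamel term is the Bochner integral `D(t) = ∫₀ᵗ P_{t-s} G(s) ds = ∫₀ᵗ P_σ G(t-σ) dσ` in `L²`,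
where `P_σ = ⟨D⟩e^{σΔ}` is any family of bounded operators with the **parabolic bound**
`‖P_σ‖ ≤ 1 + σ^{-1/2}` and the **semigroup factorisation** `P_σ = e^{(σ-ρ)Δ} P_ρ` (`0 < ρ ≤ σ`)
(part I), and `G` is a continuous bounded curve in `L²`. This file proves, abstractly in such a
family `P`:

* joint strong continuity of `(σ, h) ↦ P_σ h` on `σ > 0` (from the factorisation and the strong
  continuity of the heat propagator), hence measurability of the integrand, which has an
  integrable singularity `σ^{-1/2}` at `σ = 0`: interval integrability
  (`intervalIntegrable_smoothing`) and the bound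
  `‖∫ₐᵇ P_σ G(r-σ) dσ‖ ≤ N · |∫ₐᵇ (1 + σ^{-1/2}) dσ|` (`norm_integral_smoothing_le`);
* continuity of `t ↦ D(t)` on `[0, ∞)` (`continuousOn_duhamel`, registered sub-goal
  `stub_localExistence_Duhamel`), by splitting `D(t) − D(t₀)` into a short time integral and an
  integral of `P_σ (G(t-σ) − G(t₀-σ))`, small by uniform continuity of `G` on compacts;
* realness and closedness lemmas for `L²` limits and integrals of real fields.

## References

* T. Tao, J. Amer. Math. Soc. 29 (2016), 601–674, arXiv:1402.0290v3, §1.1 (1.15).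
-/

noncomputable section

open MeasureTheory Set Filter Topology
open scoped ENNReal NNReal Interval

set_option linter.dupNamespace false

namespace Summit.NavierStokesRegularity.NavierStokesRegularity.Theorems.PerpetualPumpThesis.E

open Literature.Analysis.FluidPDE Literature.Analysis.FluidPDE.Tao2016
open Summit.NavierStokesRegularity.NavierStokesRegularity.Theorems.PerpetualPumpEulerTypeIGlue
  (continuous_heat_apply norm_heat_le)

/-! ### Real fields: closedness and integrals -/

/-- **The real fields form a closed subset of `L²(ℝ³; ℂ³)`** (the fixed points of the continuous
conjugation). -/
theorem isClosed_setOf_isReal : IsClosed {v : L2C | IsReal v} := by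
  have h : {v : L2C | IsReal v} = {v | conjL2 v = v} := Set.ext fun v => isReal_iff_conjL2_eq v
  rw [h]
  exact isClosed_eq continuous_conjL2 continuous_id

/-- **Realness is preserved by interval (Bochner) integrals**: conjugation is a real-linear
bounded operator on `L²`, hence commutes with the integral. -/
theorem isReal_intervalIntegral {F : ℝ → L2C} {a b : ℝ}
    (hF : IntervalIntegrable F volume a b) (h : ∀ s ∈ Ι a b, IsReal (F s)) :
    IsReal (∫ s in a..b, F s) := by
  rw [isReal_iff_conjL2_eq]
  have h1 : conjL2 (∫ s in a..b, F s) =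
      (ContinuousLinearMap.compLpL 2 (volume : Measure (EuclideanSpace ℝ (Fin 3)))
        conj3.toContinuousLinearMap) (∫ s in a..b, F s) := rfl
  rw [h1, ← ContinuousLinearMap.intervalIntegral_comp_comm _ hF]
  refine intervalIntegral.integral_congr_ae (Eventually.of_forall fun s hs => ?_)
  exact (isReal_iff_conjL2_eq _).1 (h s hs)

/-! ### Joint strong continuity of the heat propagator and of the smoothing family -/

/-- The heat propagator is linear: `e^{τΔ}(u - v) = e^{τΔ}u - e^{τΔ}v`. -/
theorem heat_sub (τ : ℝ) (u v : L2C) : heat τ (u - v) = heat τ u - heat τ v :=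
  fourierMultiplier_sub _ u v

/-- **Joint strong continuity of the heat propagator**: `(τ, u) ↦ e^{τΔ}u` is continuous on
`ℝ × L²` (contraction in `u`, strongly continuous in `τ`). -/
theorem continuous_heat₂ : Continuous fun p : ℝ × L2C => heat p.1 p.2 := by
  refine continuous_iff_continuousAt.2 fun p₀ => ?_
  rw [ContinuousAt, tendsto_iff_norm_sub_tendsto_zero]
  have hb : ∀ p : ℝ × L2C,
      ‖heat p.1 p.2 - heat p₀.1 p₀.2‖ ≤ ‖p.2 - p₀.2‖ + ‖heat p.1 p₀.2 - heat p₀.1 p₀.2‖ := by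
    intro p
    calc ‖heat p.1 p.2 - heat p₀.1 p₀.2‖
        = ‖heat p.1 (p.2 - p₀.2) + (heat p.1 p₀.2 - heat p₀.1 p₀.2)‖ := by
          rw [heat_sub, sub_add_sub_cancel]
      _ ≤ ‖heat p.1 (p.2 - p₀.2)‖ + ‖heat p.1 p₀.2 - heat p₀.1 p₀.2‖ := norm_add_le _ _
      _ ≤ ‖p.2 - p₀.2‖ + ‖heat p.1 p₀.2 - heat p₀.1 p₀.2‖ := by
          gcongr
          exact norm_heat_le _ _
  have h1 : Tendsto (fun p : ℝ × L2C => ‖p.2 - p₀.2‖) (𝓝 p₀) (𝓝 0) := by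
    have hc : Continuous fun p : ℝ × L2C => ‖p.2 - p₀.2‖ :=
      (continuous_snd.sub continuous_const).norm
    simpa using hc.tendsto p₀
  have h2 : Tendsto (fun p : ℝ × L2C => ‖heat p.1 p₀.2 - heat p₀.1 p₀.2‖) (𝓝 p₀) (𝓝 0) := by
    have hc : Continuous fun p : ℝ × L2C => ‖heat p.1 p₀.2 - heat p₀.1 p₀.2‖ :=
      (((continuous_heat_apply p₀.2).comp continuous_fst).sub continuous_const).norm
    simpa using hc.tendsto p₀
  refine squeeze_zero (fun p => norm_nonneg _) hb ?_
  simpa using h1.add h2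

/-- **Joint strong continuity of the smoothing family on `σ > 0`**: for any family `P` with the
semigroup factorisation `P_σ = e^{(σ-ρ)Δ} P_ρ` (`0 < ρ ≤ σ`), the map `(σ, h) ↦ P_σ h` is
continuous at every point with `σ > 0`. -/
theorem continuousAt_smoothing₂ {P : ℝ → (L2C →L[ℂ] L2C)}
    (hPf : ∀ ρ σ : ℝ, 0 < ρ → ρ ≤ σ → ∀ h : L2C, P σ h = heat (σ - ρ) (P ρ h))
    {p₀ : ℝ × L2C} (hp₀ : 0 < p₀.1) : ContinuousAt (fun p : ℝ × L2C => P p.1 p.2) p₀ := by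
  obtain ⟨ρ, hρ, hρlt⟩ : ∃ ρ : ℝ, 0 < ρ ∧ ρ < p₀.1 := ⟨p₀.1 / 2, half_pos hp₀, half_lt_self hp₀⟩
  have hcont : Continuous fun p : ℝ × L2C => heat (p.1 - ρ) (P ρ p.2) :=
    continuous_heat₂.comp₂ (continuous_fst.sub continuous_const)
      ((P ρ).continuous.comp continuous_snd)
  refine hcont.continuousAt.congr ?_
  have hev : ∀ᶠ p : ℝ × L2C in 𝓝 p₀, ρ < p.1 :=
    (continuous_fst.tendsto p₀).eventually (p := fun x : ℝ => ρ < x) (Ioi_mem_nhds hρlt)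
  filter_upwards [hev] with p hp
  exact (hPf ρ p.1 hρ hp.le p.2).symm

/-- The Duhamel integrand `σ ↦ P_σ G(r - σ)` is continuous on `σ > 0` for a continuous curve `G`. -/
theorem continuousOn_smoothing_comp {P : ℝ → (L2C →L[ℂ] L2C)}
    (hPf : ∀ ρ σ : ℝ, 0 < ρ → ρ ≤ σ → ∀ h : L2C, P σ h = heat (σ - ρ) (P ρ h))
    {G : ℝ → L2C} (hG : Continuous G) (r : ℝ) :
    ContinuousOn (fun σ => P σ (G (r - σ))) (Ioi 0) := by
  intro σ₀ hσ₀
  have h : ContinuousAt (fun σ : ℝ => (σ, G (r - σ))) σ₀ :=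
    (continuous_id.prodMk (hG.comp (continuous_const.sub continuous_id))).continuousAt
  have h2 : ContinuousAt (fun p : ℝ × L2C => P p.1 p.2) (σ₀, G (r - σ₀)) :=
    continuousAt_smoothing₂ hPf hσ₀
  exact (ContinuousAt.comp_of_eq h2 h rfl).continuousWithinAt

/-! ### Interval integrability and the basic bound -/

/-- The dominating function `σ ↦ 1 + σ^{-1/2}` is interval integrable on every interval. -/
theorem intervalIntegrable_one_add_rpow (a b : ℝ) :
    IntervalIntegrable (fun σ : ℝ => 1 + σ ^ (-(1 / 2 : ℝ))) volume a b :=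
  intervalIntegrable_const.add (intervalIntegral.intervalIntegrable_rpow' (by norm_num))

/-- **Interval integrability of the Duhamel integrand** `σ ↦ P_σ G(r-σ)` on `[a, b] ⊂ [0, ∞)`:
it is continuous on `σ > 0` and dominated by `(1 + σ^{-1/2}) N` where `‖G‖ ≤ N` on the range. -/
theorem intervalIntegrable_smoothing {P : ℝ → (L2C →L[ℂ] L2C)}
    (hPb : ∀ σ : ℝ, 0 < σ → ‖P σ‖ ≤ 1 + σ ^ (-(1 / 2 : ℝ)))
    (hPf : ∀ ρ σ : ℝ, 0 < ρ → ρ ≤ σ → ∀ h : L2C, P σ h = heat (σ - ρ) (P ρ h))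
    {G : ℝ → L2C} (hG : Continuous G) (r : ℝ) {a b : ℝ} (ha : 0 ≤ a) (hb : 0 ≤ b)
    {N : ℝ} (hN : ∀ σ ∈ Ι a b, ‖G (r - σ)‖ ≤ N) :
    IntervalIntegrable (fun σ => P σ (G (r - σ))) volume a b := by
  have hsub : Ι a b ⊆ Ioi 0 := fun σ hσ => lt_of_le_of_lt (le_min ha hb) hσ.1
  refine IntervalIntegrable.mono_fun' (g := fun σ => (1 + σ ^ (-(1 / 2 : ℝ))) * N)
    ((intervalIntegrable_one_add_rpow a b).mul_const _) ?_ ?_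
  · exact ((continuousOn_smoothing_comp hPf hG r).mono hsub).aestronglyMeasurable
      measurableSet_uIoc
  · refine ae_restrict_of_forall_mem measurableSet_uIoc fun σ hσ => ?_
    have hσ0 : 0 < σ := hsub hσ
    calc ‖P σ (G (r - σ))‖ ≤ ‖P σ‖ * ‖G (r - σ)‖ := ContinuousLinearMap.le_opNorm _ _
      _ ≤ (1 + σ ^ (-(1 / 2 : ℝ))) * N :=
          mul_le_mul (hPb σ hσ0) (hN σ hσ) (norm_nonneg _) (by positivity)

/-- **The basic bound** on the Duhamel integral:
`‖∫ₐᵇ P_σ G(r-σ) dσ‖ ≤ N · |∫ₐᵇ (1 + σ^{-1/2}) dσ|` whenever `‖G(r-σ)‖ ≤ N` on the range. -/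
theorem norm_integral_smoothing_le {P : ℝ → (L2C →L[ℂ] L2C)}
    (hPb : ∀ σ : ℝ, 0 < σ → ‖P σ‖ ≤ 1 + σ ^ (-(1 / 2 : ℝ)))
    (r : ℝ) (G : ℝ → L2C) {a b : ℝ} (ha : 0 ≤ a) (hb : 0 ≤ b)
    {N : ℝ} (hN0 : 0 ≤ N) (hN : ∀ σ ∈ Ι a b, ‖G (r - σ)‖ ≤ N) :
    ‖∫ σ in a..b, P σ (G (r - σ))‖ ≤ N * |∫ σ in a..b, (1 + σ ^ (-(1 / 2 : ℝ)))| := by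
  have hsub : Ι a b ⊆ Ioi 0 := fun σ hσ => lt_of_le_of_lt (le_min ha hb) hσ.1
  have h := intervalIntegral.norm_integral_le_abs_of_norm_le
    (f := fun σ => P σ (G (r - σ))) (g := fun σ => (1 + σ ^ (-(1 / 2 : ℝ))) * N)
    (μ := volume) (a := a) (b := b) ?_ ((intervalIntegrable_one_add_rpow a b).mul_const _)
  · rw [intervalIntegral.integral_mul_const, abs_mul, abs_of_nonneg hN0, mul_comm] at h
    exact h
  · refine ae_restrict_of_forall_mem measurableSet_uIoc fun σ hσ => ?_
    have hσ0 : 0 < σ := hsub hσ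
    calc ‖P σ (G (r - σ))‖ ≤ ‖P σ‖ * ‖G (r - σ)‖ := ContinuousLinearMap.le_opNorm _ _
      _ ≤ (1 + σ ^ (-(1 / 2 : ℝ))) * N :=
          mul_le_mul (hPb σ hσ0) (hN σ hσ) (norm_nonneg _) (by positivity)

/-- **Change of variables** `∫₀ᵗ P_{t-s} G(s) ds = ∫₀ᵗ P_σ G(t-σ) dσ`. -/
theorem integral_smoothing_comp_sub (P : ℝ → (L2C →L[ℂ] L2C)) (G : ℝ → L2C) (t : ℝ) :
    ∫ s in (0 : ℝ)..t, P (t - s) (G s) = ∫ σ in (0 : ℝ)..t, P σ (G (t - σ)) := by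
  have h := intervalIntegral.integral_comp_sub_left (fun σ => P σ (G (t - σ))) t (a := 0) (b := t)
  simp only [sub_sub_cancel, sub_self, sub_zero] at h
  exact h

/-- Interval integrability of the Duhamel integrand in the original variable,
`s ↦ P_{t-s} G(s)` on `[0, t]`, for a continuous curve bounded on `[0, t]`. -/
theorem intervalIntegrable_smoothing_sub {P : ℝ → (L2C →L[ℂ] L2C)}
    (hPb : ∀ σ : ℝ, 0 < σ → ‖P σ‖ ≤ 1 + σ ^ (-(1 / 2 : ℝ)))
    (hPf : ∀ ρ σ : ℝ, 0 < ρ → ρ ≤ σ → ∀ h : L2C, P σ h = heat (σ - ρ) (P ρ h))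
    {G : ℝ → L2C} (hG : Continuous G) {t : ℝ} (ht : 0 ≤ t)
    {N : ℝ} (hN : ∀ s, ‖G s‖ ≤ N) :
    IntervalIntegrable (fun s => P (t - s) (G s)) volume 0 t := by
  have h := (intervalIntegrable_smoothing hPb hPf hG t ht le_rfl
    (a := t) (b := 0) (N := N) (fun σ _ => hN _)).comp_sub_left t
  simpa only [sub_sub_cancel, sub_self, sub_zero] using h

/-! ### Continuity in time of the Duhamel integral -/

/-- **Continuity of the lifted Duhamel integral** `t ↦ ∫₀ᵗ P_σ G(t-σ) dσ` on `[0, ∞)`, for a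
continuous bounded curve `G` in `L²` and any smoothing family `P` with the parabolic bound and
the semigroup factorisation. -/
theorem continuousOn_duhamel {P : ℝ → (L2C →L[ℂ] L2C)}
    (hPb : ∀ σ : ℝ, 0 < σ → ‖P σ‖ ≤ 1 + σ ^ (-(1 / 2 : ℝ)))
    (hPf : ∀ ρ σ : ℝ, 0 < ρ → ρ ≤ σ → ∀ h : L2C, P σ h = heat (σ - ρ) (P ρ h))
    {G : ℝ → L2C} (hG : Continuous G) {N : ℝ} (hN0 : 0 ≤ N) (hN : ∀ s, ‖G s‖ ≤ N) :
    ContinuousOn (fun t => ∫ σ in (0 : ℝ)..t, P σ (G (t - σ))) (Ici 0) := by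
  intro t₀ ht₀
  replace ht₀ : 0 ≤ t₀ := ht₀
  rw [Metric.continuousWithinAt_iff]
  intro ε hε
  -- the dominating primitive is continuous
  have hβc : Continuous fun t => ∫ σ in t₀..t, (1 + σ ^ (-(1 / 2 : ℝ))) :=
    intervalIntegral.continuous_primitive intervalIntegrable_one_add_rpow t₀
  -- term A: the short time integral
  have hA : ∀ᶠ t in 𝓝 t₀, N * |∫ σ in t₀..t, (1 + σ ^ (-(1 / 2 : ℝ)))| < ε / 2 := by
    have h : Tendsto (fun t => N * |∫ σ in t₀..t, (1 + σ ^ (-(1 / 2 : ℝ)))|) (𝓝 t₀)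
        (𝓝 (N * |∫ σ in t₀..t₀, (1 + σ ^ (-(1 / 2 : ℝ)))|)) :=
      (continuous_const.mul (continuous_abs.comp hβc)).tendsto t₀
    rw [intervalIntegral.integral_same, abs_zero, mul_zero] at h
    exact h (Iio_mem_nhds (half_pos hε))
  -- term B: uniform continuity of `G` on a compact interval
  set C : ℝ := |∫ σ in (0 : ℝ)..t₀, (1 + σ ^ (-(1 / 2 : ℝ)))| with hC
  have hC0 : 0 ≤ C := abs_nonneg _
  obtain ⟨η, hη, hηε⟩ : ∃ η : ℝ, 0 < η ∧ η * C < ε / 2 := by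
    refine ⟨ε / 2 / (C + 1), by positivity, ?_⟩
    rw [div_mul_eq_mul_div, div_lt_iff₀ (by positivity)]
    nlinarith
  have huc := (isCompact_Icc (a := (-1 : ℝ)) (b := t₀ + 1)).uniformContinuousOn_of_continuous
    hG.continuousOn
  rw [Metric.uniformContinuousOn_iff_le] at huc
  obtain ⟨δ₂, hδ₂, hδ₂'⟩ := huc η hη
  have hB : ∀ᶠ t in 𝓝 t₀, dist t t₀ < min δ₂ 1 := Metric.ball_mem_nhds t₀ (by positivity)
  obtain ⟨δ, hδ, hδ'⟩ := Metric.eventually_nhds_iff.1 (hA.and hB)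
  refine ⟨δ, hδ, fun t ht hdist => ?_⟩
  replace ht : 0 ≤ t := ht
  obtain ⟨hAt, hBt⟩ := hδ' hdist
  have hBt1 : |t - t₀| < 1 := (lt_min_iff.1 hBt).2.trans_eq' (Real.dist_eq t t₀).symm
  have hBt2 : |t - t₀| ≤ δ₂ := ((lt_min_iff.1 hBt).1.trans_eq' (Real.dist_eq t t₀).symm).le
  -- the three integrability facts
  have hI1 : IntervalIntegrable (fun σ => P σ (G (t - σ))) volume 0 t :=
    intervalIntegrable_smoothing hPb hPf hG t le_rfl ht (fun σ _ => hN _)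
  have hI2 : IntervalIntegrable (fun σ => P σ (G (t - σ))) volume 0 t₀ :=
    intervalIntegrable_smoothing hPb hPf hG t le_rfl ht₀ (fun σ _ => hN _)
  have hI3 : IntervalIntegrable (fun σ => P σ (G (t₀ - σ))) volume 0 t₀ :=
    intervalIntegrable_smoothing hPb hPf hG t₀ le_rfl ht₀ (fun σ _ => hN _)
  -- the decomposition
  have hdec : (∫ σ in (0 : ℝ)..t, P σ (G (t - σ))) - ∫ σ in (0 : ℝ)..t₀, P σ (G (t₀ - σ)) =
      (∫ σ in t₀..t, P σ (G (t - σ))) +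
        ∫ σ in (0 : ℝ)..t₀, P σ ((fun x => G (x + (t - t₀)) - G x) (t₀ - σ)) := by
    have h3 : (fun σ => P σ ((fun x => G (x + (t - t₀)) - G x) (t₀ - σ))) =
        fun σ => P σ (G (t - σ)) - P σ (G (t₀ - σ)) := by
      funext σ
      rw [← map_sub]
      congr 2
      ring_nf
    rw [h3, intervalIntegral.integral_sub hI2 hI3,
      ← intervalIntegral.integral_interval_sub_left hI1 hI2]
    abel
  -- term A estimate
  have hAe : ‖∫ σ in t₀..t, P σ (G (t - σ))‖ < ε / 2 :=
    (norm_integral_smoothing_le hPb t G ht₀ ht hN0 (fun σ _ => hN _)).trans_lt hAt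
  -- term B estimate
  have hBe : ‖∫ σ in (0 : ℝ)..t₀, P σ ((fun x => G (x + (t - t₀)) - G x) (t₀ - σ))‖ < ε / 2 := by
    refine (norm_integral_smoothing_le hPb t₀ (fun x => G (x + (t - t₀)) - G x) le_rfl ht₀ hη.le
      fun σ hσ => ?_).trans_lt hηε
    rw [uIoc_of_le ht₀] at hσ
    have hx : t₀ - σ ∈ Icc (-1) (t₀ + 1) := ⟨by linarith [hσ.2], by linarith [hσ.1]⟩
    have hy : t₀ - σ + (t - t₀) ∈ Icc (-1) (t₀ + 1) := by
      obtain ⟨h1, h2⟩ := abs_lt.1 hBt1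
      constructor <;> linarith [hσ.1, hσ.2]
    have hd : dist (t₀ - σ + (t - t₀)) (t₀ - σ) ≤ δ₂ := by
      rw [Real.dist_eq, add_sub_cancel_left]
      exact hBt2
    have h := hδ₂' _ hy _ hx hd
    rwa [dist_eq_norm] at h
  -- conclusion
  rw [dist_eq_norm, hdec]
  calc ‖(∫ σ in t₀..t, P σ (G (t - σ))) +
        ∫ σ in (0 : ℝ)..t₀, P σ ((fun x => G (x + (t - t₀)) - G x) (t₀ - σ))‖
      ≤ ‖∫ σ in t₀..t, P σ (G (t - σ))‖ +
        ‖∫ σ in (0 : ℝ)..t₀, P σ ((fun x => G (x + (t - t₀)) - G x) (t₀ - σ))‖ := norm_add_le _ _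
    _ < ε / 2 + ε / 2 := add_lt_add hAe hBe
    _ = ε := by ring

end E

open Literature.Analysis.FluidPDE Literature.Analysis.FluidPDE.Tao2016

/-- **Registered sub-goal `stub_localExistence_Duhamel`** of stub E (`localExistence`): continuity
in time of the lifted Duhamel integral for any smoothing family with the parabolic bound and the
semigroup factorisation (`E.continuousOn_duhamel`). -/
theorem stub_localExistence_Duhamel : ∀ (P : ℝ → (L2C →L[ℂ] L2C)) (G : ℝ → L2C) (N : ℝ), (∀ σ : ℝ, 0 < σ → ‖P σ‖ ≤ 1 + σ ^ (-(1 / 2 : ℝ))) → (∀ ρ σ : ℝ, 0 < ρ → ρ ≤ σ → ∀ h : L2C, P σ h = heat (σ - ρ) (P ρ h)) → Continuous G → 0 ≤ N → (∀ s, ‖G s‖ ≤ N) → ContinuousOn (fun t => ∫ σ in (0 : ℝ)..t, P σ (G (t - σ))) (Ici 0) :=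
  fun _ _ _ hPb hPf hG hN0 hN => E.continuousOn_duhamel hPb hPf hG hN0 hN

end Summit.NavierStokesRegularity.NavierStokesRegularity.Theorems.PerpetualPumpThesis
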